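import Mathlib.Tactic
import HarnessLib

/-!
# Kozma–Nitzan's Question 8 at three relays — the ZERO-MASS COORDINATES behind THEOREM F (C3 corner, c ≤ 0; gen 22)

Support file (`--supports stmt-CriticalPhenomena-4575`, closed crux; independent mathematics on Kozma–Nitzan's Question 8,
arXiv:2401.12397 §5.5 p. 36), prover `prim-ineq-gen-6` (gen 22).  No definitions, no named facts, no sorries; standard axioms.
Memo `run/shared/lean/prim/prim-ineq-gen-6/PROOF-C3-PATHEND-G22.md` §2–§3.

At the corner C3 the one-level ('(V₃)') class vector of a pendant block lives in the 7-dimensional basis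
`(1, α̂, γ̂, μ̂, ν̂ | μ̂⁰, ν̂⁰)`; the zero-mass hyperplane has the basis `n₁ = (Φ₁,−1,−1,1,0|0,0)`, `n₂ = (π₁,0,−1,0,0|0,0)`,
`n₃ = (ε₁,−1,0,0,0|0,0)`, `n₅ = (n̄,0,0,0,−1|0,0)`, `r_μ = (0,0,0,1,0|−1,0)`, `r_ν = (0,0,0,0,1|0,−1)` (sub-block hats and moments).
After folding the root `a` of `T = a –s– T₁` (root parameters `A, C`; `g = (1−s)G₀({a})/Φ₁`) the vector is
`F = (sΦσ, −s(Φσ−c)A + g, −s(Φ+m−c)C + g, s(Φ+m−2c+Φσ)AC − 2g, −sΦσAC | s(κ₀−Φσ)AC + g, sΦσAC)` (T's constants), and the two induction generators are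
the (V₃) vectors of `S = T₁[A,C]` and `G = T₁[A,1]`:  `θ‴ = (Φ'σ', −(Φ'σ'−c')A', −(Φ'+m'−c')C', (Φ'+m'−2c'+Φ'σ')A'C', −Φ'σ'A'C' | (κ'−Φ'σ')A'C', Φ'σ'A'C')`
with `(A',C') = (A,C)` resp. `(A,1)`.  `c3_foldVector_expand` gives the coordinates of `F − ℓθ‴_S − ℓ₃θ‴_G` in the basis above:
they are C2's coordinates `R₁, R₂, R₃, R₀'` (PROOF-C2-PATHEND-G21 §4, Lean `c2_foldVector_expand`) in `n₁,n₂,n₃`, zero in `n₅`, and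
`ρ_ν = e₄ := −(sΦσAC − ℓΦ''σ''AC − ℓ₃Φ₃σ₃A)`, `ρ_μ = R₀' − e₄`; `c3_q_rewrite` is the change to the pointwise good
`q = r_μ/Φ₁ − r_ν`, and `c3_q_pointwise_nonneg` its classwise nonnegativity `A'C'(p'/Φ₁ − 1) ≥ 0` for `p' ≥ Φ₁ > 0`.
[cite: KozmaNitzan2024, Question 8 (§5.5 p. 36)]
-/

namespace Summit.CriticalPhenomena.PercolationContinuityZ3.Theorems

namespace PocketCert

/-- **Zero-mass coordinates of the folded (V₃) vector minus the two induction generators** (componentwise in the basis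
`(1, α̂, γ̂, μ̂, ν̂ | μ̂⁰, ν̂⁰)`; the first component is the zero-mass constraint and is the hypothesis `hmass`).  Constants of `T`:
`Φ σ m c κ₀`; of `S = T₁[A,C]`: `ΦS σS mS cS κS`; of `G = T₁[A,1]`: `Φ3 σ3 m3 c3 κ3`; multipliers `ℓ, ℓ₃`; `X = (Φ+m)Φ − c`,
`Y = (Φσ−c) − C·X`, `Z = (Φ+m−c) − A·X` and likewise for `S` (root parameters `A, C`) and `G` (root parameters `A, 1`);
`κ = c − (Φ+m)(1−Φ)` for each block (hypotheses `hκ, hκS, hκ3`).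
[cite: KozmaNitzan2024, Question 8 (§5.5 p. 36)] -/
theorem c3_foldVector_expand (Φ σ m c κ₀ ΦS σS mS cS κS Φ3 σ3 m3 c3 κ3 s A C g ℓ ℓ₃ Φ₁ π₁ ε₁ nb : ℝ)
    (hmass : s * Φ * σ - ℓ * (ΦS * σS) - ℓ₃ * (Φ3 * σ3)
        = (s * A * C * ((Φ + m) * Φ - c) - g - ℓ * (A * C * ((ΦS + mS) * ΦS - cS)) - ℓ₃ * (A * ((Φ3 + m3) * Φ3 - c3))) * Φ₁
          + (s * C * ((Φ + m - c) - A * ((Φ + m) * Φ - c)) - ℓ * (C * ((ΦS + mS - cS) - A * ((ΦS + mS) * ΦS - cS)))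
              - ℓ₃ * ((Φ3 + m3 - c3) - A * ((Φ3 + m3) * Φ3 - c3))) * π₁
          + (s * A * ((Φ * σ - c) - C * ((Φ + m) * Φ - c)) - ℓ * (A * ((ΦS * σS - cS) - C * ((ΦS + mS) * ΦS - cS)))
              - ℓ₃ * (A * ((Φ3 * σ3 - c3) - ((Φ3 + m3) * Φ3 - c3)))) * ε₁ + 0 * nb)
    (hκ : κ₀ = c - (Φ + m) * (1 - Φ)) (hκS : κS = cS - (ΦS + mS) * (1 - ΦS)) (hκ3 : κ3 = c3 - (Φ3 + m3) * (1 - Φ3)) :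
    let X := (Φ + m) * Φ - c
    let Y := (Φ * σ - c) - C * X
    let Z := (Φ + m - c) - A * X
    let XS := (ΦS + mS) * ΦS - cS
    let YS := (ΦS * σS - cS) - C * XS
    let ZS := (ΦS + mS - cS) - A * XS
    let X3 := (Φ3 + m3) * Φ3 - c3
    let Y3 := (Φ3 * σ3 - c3) - X3
    let Z3 := (Φ3 + m3 - c3) - A * X3
    let ν₁ := s * A * C * X - g - ℓ * (A * C * XS) - ℓ₃ * (A * X3)
    let ν₂ := s * C * Z - ℓ * (C * ZS) - ℓ₃ * Z3
    let ν₃ := s * A * Y - ℓ * (A * YS) - ℓ₃ * (A * Y3)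
    let ν₅ := (0 : ℝ)
    let e₄ := -(s * Φ * σ * A * C - ℓ * (ΦS * σS) * A * C - ℓ₃ * (Φ3 * σ3) * A)
    let R₀ := -(s * A * C * κ₀ + g) + ℓ * (A * C * κS) + ℓ₃ * (A * κ3)
    let ρμ := R₀ - e₄
    let ρν := e₄
    -- the seven components of F − ℓ θ‴_S − ℓ₃ θ‴_G  =  ν₁ n₁ + ν₂ n₂ + ν₃ n₃ + ν₅ n₅ + ρμ r_μ + ρν r_ν
    (s * Φ * σ - ℓ * (ΦS * σS) - ℓ₃ * (Φ3 * σ3) = ν₁ * Φ₁ + ν₂ * π₁ + ν₃ * ε₁ + ν₅ * nb) ∧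
    ((-(s * (Φ * σ - c) * A) + g) - ℓ * (-(ΦS * σS - cS) * A) - ℓ₃ * (-(Φ3 * σ3 - c3) * A) = ν₁ * (-1) + ν₃ * (-1)) ∧
    ((-(s * (Φ + m - c) * C) + g) - ℓ * (-(ΦS + mS - cS) * C) - ℓ₃ * (-(Φ3 + m3 - c3)) = ν₁ * (-1) + ν₂ * (-1)) ∧
    ((s * (Φ + m - 2 * c + Φ * σ) * A * C - 2 * g) - ℓ * ((ΦS + mS - 2 * cS + ΦS * σS) * A * C)
        - ℓ₃ * ((Φ3 + m3 - 2 * c3 + Φ3 * σ3) * A) = ν₁ * 1 + ρμ * 1) ∧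
    ((-(s * Φ * σ * A * C)) - ℓ * (-(ΦS * σS) * A * C) - ℓ₃ * (-(Φ3 * σ3) * A) = ν₅ * (-1) + ρν * 1) ∧
    ((s * (κ₀ - Φ * σ) * A * C + g) - ℓ * ((κS - ΦS * σS) * A * C) - ℓ₃ * ((κ3 - Φ3 * σ3) * A) = ρμ * (-1)) ∧
    ((s * Φ * σ * A * C) - ℓ * (ΦS * σS * A * C) - ℓ₃ * (Φ3 * σ3 * A) = ρν * (-1)) := by
  intro X Y Z XS YS ZS X3 Y3 Z3 ν₁ ν₂ ν₃ ν₅ e₄ R₀ ρμ ρν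
  simp only [X, Y, Z, XS, YS, ZS, X3, Y3, Z3, ν₁, ν₂, ν₃, ν₅, e₄, R₀, ρμ, ρν]
  refine ⟨?_, by ring, by ring, ?_, by ring, by ring, by ring⟩
  · linear_combination hmass
  · rw [hκ, hκS, hκ3]; ring

/-- **Rewriting a negative `r_ν`-coordinate through the pointwise good `q = r_μ/Φ₁ − r_ν`**:  for the (μ̂, ν̂ | μ̂⁰, ν̂⁰)-components,
`ρμ·r_μ + ρν·r_ν = (ρμ + ρν/Φ₁)·r_μ + (−ρν)·q` (use with `ρν ≤ 0`, so that `−ρν ≥ 0`).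
[cite: KozmaNitzan2024, Question 8 (§5.5 p. 36)] -/
theorem c3_q_rewrite (ρμ ρν Φ₁ : ℝ) :
    -- components (μ̂, ν̂ | μ̂⁰, ν̂⁰): r_μ = (1,0|−1,0), r_ν = (0,1|0,−1), q = (1/Φ₁,−1|−1/Φ₁,1)
    (ρμ * 1 + ρν * 0 = (ρμ + ρν / Φ₁) * 1 + (-ρν) * (1 / Φ₁)) ∧
    (ρμ * 0 + ρν * 1 = (ρμ + ρν / Φ₁) * 0 + (-ρν) * (-1)) ∧
    (ρμ * (-1) + ρν * 0 = (ρμ + ρν / Φ₁) * (-1) + (-ρν) * (-(1 / Φ₁))) ∧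
    (ρμ * 0 + ρν * (-1) = (ρμ + ρν / Φ₁) * 0 + (-ρν) * 1) := by
  refine ⟨by ring, by ring, by ring, by ring⟩

/-- **The good `q` is classwise nonnegative**: its class function on `K₁ − K₀` is `μ̂'/Φ₁ − ν̂' = A'C'(p'/Φ₁ − 1) ≥ 0` whenever
`0 < Φ₁ ≤ p'` (LEMMA `Φ ≤ p_R`) and `0 ≤ A', C'`.  [cite: KozmaNitzan2024, Question 8 (§5.5 p. 36)] -/
theorem c3_q_pointwise_nonneg (Φ₁ p' A' C' : ℝ) (hΦ : 0 < Φ₁) (hp : Φ₁ ≤ p') (hA : 0 ≤ A') (hC : 0 ≤ C') :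
    0 ≤ (p' * A' * C') / Φ₁ - A' * C' := by
  have h1 : (p' * A' * C') / Φ₁ - A' * C' = A' * C' * (p' / Φ₁ - 1) := by ring
  rw [h1]
  have h2 : 1 ≤ p' / Φ₁ := by rw [le_div_iff₀ hΦ]; linarith
  exact mul_nonneg (mul_nonneg hA hC) (by linarith)

/-- **The coordinate condition of THEOREM F** (PROOF-C3-PATHEND-G22 §3): with `ρν = e₄ ≤ 0` and `ρμ = R₀' − e₄`, the `r_μ`-coefficient after the
`q`-rewrite is `ρμ + ρν/Φ₁ = R₀' − e₄ + e₄/Φ₁`, and it is `≥ 0` as soon as `Φ₁·R₀' ≥ (1−Φ₁)·(−e₄)` (certificate (N0)) and `0 < Φ₁`.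
[cite: KozmaNitzan2024, Question 8 (§5.5 p. 36)] -/
theorem c3_rmu_coeff_nonneg (R₀ e₄ Φ₁ : ℝ) (hΦ : 0 < Φ₁) (hN0 : (1 - Φ₁) * (-e₄) ≤ Φ₁ * R₀) :
    0 ≤ (R₀ - e₄) + e₄ / Φ₁ := by
  have h : (R₀ - e₄) + e₄ / Φ₁ = (Φ₁ * R₀ - (1 - Φ₁) * (-e₄)) / Φ₁ := by
    field_simp; ring
  rw [h]
  exact div_nonneg (by linarith) hΦ.le

end PocketCert

end Summit.CriticalPhenomena.PercolationContinuityZ3.Theorems
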